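import Mathlib
import HarnessLib
import Summits.Ventures.LatticeQCDFlow.Exactness.NCMCGeneralSpacePhaseChordLemmas

/-!
# The phase-chord functional along the chain: one step is controlled by the martingale variance (`D ≤ 4π² σ²`), `j` steps by `j² D`

HONEST FRAMING: exact (Metropolis-corrected) sampling algorithms for lattice gauge theory;
figures of merit are autocorrelation/cost numbers at stated couplings and volumes; no
continuum-physics claim.

Venture `LatticeQCDFlow` (cell pub-lqcd), topic `Exactness`; FANOUT row 13 (`eng-snf`, GEN-21).
NEW WORK of the cell, not a published result; no definition is introduced; nothing is cited as a
fact.  Second preparatory file for `NCMCGeneralSpaceEventTauIntFloor`.  For a measurable phase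
`θ : S → ℝ`, a shift `q` and a Markov kernel `κ` with invariant law `π`, write
`W_c(x, y) = 4 sin²(π(θ y − θ x − c))` (squared chord between the unit vectors at angles `2πθ(y)` and
`2π(θ(x) + c)`), `D = ∫_π ∫_κ W_q` and `D_j = ∫_π ∫_{κ^j} W_{jq}`.

## Content

* §1 **`integral_chord_le_condVar`**, **`chordOne_le_condVar`** — if `θ = h` is a bounded Poisson-type
  phase, i.e. `h(x) + q − κh(x) ∈ {0, 1}` for every `x` (the case of the Poisson solution of a centred
  INDICATOR, `q = π(A)`), then `∫_κ W_q(x, ·) ≤ 4π² (κ(h²)(x) − (κh(x))²)` and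
  `D ≤ 4π² (∫ h² dπ − ∫ (κh)² dπ) = 4π² σ²`.
* §2 **`chord_recursion`** — for `j ≥ 1`: `j D_{j+1} ≤ j(1+j) D + (1+j) D_j` (weighted triangle
  inequality for chords through the intermediate point `X_j`, invariance of `π` under `κ^j`);
  **`chord_nHit_le`** — `D_j ≤ j² D` for every `j ≥ 1`.

NOT CLAIMED: anything numerical.
-/

namespace Summit.Ventures.LatticeQCDFlow.Exactness.GeneralNCMC

open MeasureTheory ProbabilityTheory Set Filter Finset
open scoped ENNReal NNReal Topology

variable {S : Type*} [MeasurableSpace S]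

/-! ## §1 One step: the chord is controlled by the martingale increment -/

section OneStep

variable (κ : Kernel S S) [IsMarkovKernel κ]

/-- **One-step chord vs. conditional variance.**  If `h` is bounded measurable and
`h(x) + q − κh(x) ∈ {0, 1}` then `∫ 4 sin²(π(h y − h x − q)) κ(x, dy) ≤ 4π² (κ(h²)(x) − (κh(x))²)`. -/
theorem integral_chord_le_condVar {h : S → ℝ} (hhm : Measurable h) {Ch : ℝ} (hhb : ∀ x, |h x| ≤ Ch)
    {q : ℝ} (hstep : ∀ x, h x + q - Scoring.kop κ h x = 0 ∨ h x + q - Scoring.kop κ h x = 1) (x : S) :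
    ∫ y, 4 * Real.sin (Real.pi * (h y - h x - q)) ^ 2 ∂(κ x)
      ≤ 4 * Real.pi ^ 2 * (Scoring.kop κ (fun y => h y ^ 2) x - (Scoring.kop κ h x) ^ 2) := by
  obtain ⟨hKm, hKb⟩ := Scoring.iterate_kop_bounded_measurable κ hhm hhb 1
  simp only [Function.iterate_one] at hKm hKb
  rw [kop_sq_sub_sq_eq_integral κ hhm hhb x, ← integral_const_mul]
  have hi2 : Integrable (fun y => 4 * Real.pi ^ 2 * (h y - Scoring.kop κ h x) ^ 2) (κ x) :=
    (Scoring.integrable_of_bounded _ ((hhm.sub_const _).pow_const 2) (C := (Ch + Ch) ^ 2) fun y => by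
      rw [abs_pow]
      exact pow_le_pow_left₀ (abs_nonneg _) ((abs_sub _ _).trans (add_le_add (hhb y) (hKb x))) 2
      ).const_mul _
  refine integral_mono (Scoring.integrable_of_bounded _ (measurable_chord_right hhm q x)
    (abs_chord_le q x)) hi2 fun y => ?_
  have hk : Real.pi * (h y - h x - q)
      = Real.pi * (h y - Scoring.kop κ h x) - (h x + q - Scoring.kop κ h x) * Real.pi := by ring
  show 4 * Real.sin (Real.pi * (h y - h x - q)) ^ 2 ≤ 4 * Real.pi ^ 2 * (h y - Scoring.kop κ h x) ^ 2
  rw [hk, sin_sq_sub_indicator _ _ (hstep x)]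
  exact four_sin_sq_le _

variable {κ} {π : Measure S} [IsProbabilityMeasure π]

/-- **`D ≤ 4π² σ²`**: the mean one-step chord of a Poisson-type phase is at most `4π²` times the
martingale variance `∫ h² dπ − ∫ (κh)² dπ` (`π` invariant). -/
theorem chordOne_le_condVar (hπ : Kernel.Invariant κ π) {h : S → ℝ} (hhm : Measurable h) {Ch : ℝ}
    (hhb : ∀ x, |h x| ≤ Ch) {q : ℝ}
    (hstep : ∀ x, h x + q - Scoring.kop κ h x = 0 ∨ h x + q - Scoring.kop κ h x = 1) :
    ∫ x, ∫ y, 4 * Real.sin (Real.pi * (h y - h x - q)) ^ 2 ∂(κ x) ∂π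
      ≤ 4 * Real.pi ^ 2 * (∫ x, h x ^ 2 ∂π - ∫ x, (Scoring.kop κ h x) ^ 2 ∂π) := by
  obtain ⟨hKm, hKb⟩ := Scoring.iterate_kop_bounded_measurable κ hhm hhb 1
  simp only [Function.iterate_one] at hKm hKb
  rw [← integral_condVar_eq_sq_sub_sq_kop hπ hhm hhb, ← integral_const_mul]
  have hqm : Measurable fun x => Scoring.kop κ (fun y => h y ^ 2) x - (Scoring.kop κ h x) ^ 2 :=
    (Scoring.measurable_kop κ (hhm.pow_const 2)).sub (hKm.pow_const 2)
  have hqb : ∀ x, |Scoring.kop κ (fun y => h y ^ 2) x - (Scoring.kop κ h x) ^ 2| ≤ Ch ^ 2 + Ch ^ 2 :=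
    fun x => (abs_sub _ _).trans (add_le_add
      (Scoring.abs_kop_le κ (fun y => by
        rw [abs_pow]; exact pow_le_pow_left₀ (abs_nonneg _) (hhb y) 2) x)
      (by rw [abs_pow]; exact pow_le_pow_left₀ (abs_nonneg _) (hKb x) 2))
  exact integral_mono (Scoring.integrable_of_bounded π (measurable_integral_chord κ hhm q)
      (abs_integral_chord_le κ q))
    ((Scoring.integrable_of_bounded π hqm hqb).const_mul _)
    fun x => integral_chord_le_condVar κ hhm hhb hstep x

end OneStep

/-! ## §2 `j` steps: `D_j ≤ j² D` -/

section Steps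

variable {κ : Kernel S S} [IsMarkovKernel κ] {π : Measure S} [IsProbabilityMeasure π]

/-- **The chord recursion**: for `j ≥ 1`, `j D_{j+1} ≤ j(1+j) D + (1+j) D_j`. -/
theorem chord_recursion (hπ : Kernel.Invariant κ π) {θ : S → ℝ} (hθ : Measurable θ) (q : ℝ)
    (j : ℕ) :
    (j : ℝ) * ∫ x, ∫ y, 4 * Real.sin (Real.pi * (θ y - θ x - ((j : ℝ) + 1) * q)) ^ 2
        ∂(nHit κ (j + 1) x) ∂π
      ≤ (j : ℝ) * (1 + j) * ∫ x, ∫ y, 4 * Real.sin (Real.pi * (θ y - θ x - q)) ^ 2 ∂(κ x) ∂π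
        + (1 + j) * ∫ x, ∫ y, 4 * Real.sin (Real.pi * (θ y - θ x - j * q)) ^ 2 ∂(nHit κ j x) ∂π := by
  haveI := isMarkovKernel_nHit κ j
  haveI := isMarkovKernel_nHit κ (j + 1)
  have hj0 : (0 : ℝ) ≤ j := Nat.cast_nonneg j
  have hj1 : (0 : ℝ) ≤ 1 + j := by linarith
  -- `G z = ∫ W_q(z, y) κ(z, dy)`: measurable, `|G| ≤ 4`
  have hGm := measurable_integral_chord (θ := θ) κ hθ q
  have hGb := abs_integral_chord_le (θ := θ) κ q
  -- pointwise in the base point `x`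
  have hpt : ∀ x, (j : ℝ) * ∫ y, 4 * Real.sin (Real.pi * (θ y - θ x - ((j : ℝ) + 1) * q)) ^ 2
        ∂(nHit κ (j + 1) x)
      ≤ (j : ℝ) * (1 + j) * Scoring.kop (nHit κ j)
          (fun z => ∫ y, 4 * Real.sin (Real.pi * (θ y - θ z - q)) ^ 2 ∂(κ z)) x
        + (1 + j) * ∫ z, 4 * Real.sin (Real.pi * (θ z - θ x - j * q)) ^ 2 ∂(nHit κ j x) := by
    intro x
    -- unfold the `(j+1)`-step kernel: first `j` steps to `z`, then one step to `y`
    have hWm := measurable_chord_right hθ (((j : ℝ) + 1) * q) x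
    have hWb := abs_chord_le (θ := θ) (((j : ℝ) + 1) * q) x
    have hcomp : ∫ y, 4 * Real.sin (Real.pi * (θ y - θ x - ((j : ℝ) + 1) * q)) ^ 2 ∂(nHit κ (j + 1) x)
        = ∫ z, ∫ y, 4 * Real.sin (Real.pi * (θ y - θ x - ((j : ℝ) + 1) * q)) ^ 2 ∂(κ z)
          ∂(nHit κ j x) := by
      rw [nHit_succ, Kernel.integral_comp (Scoring.integrable_of_bounded _ hWm hWb)]
    rw [hcomp]
    -- inner measurability / bounds in `z`
    have hIm : Measurable fun z => ∫ y, 4 * Real.sin (Real.pi * (θ y - θ x - ((j : ℝ) + 1) * q)) ^ 2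
        ∂(κ z) := Scoring.measurable_kop κ hWm
    have hIb : ∀ z, |∫ y, 4 * Real.sin (Real.pi * (θ y - θ x - ((j : ℝ) + 1) * q)) ^ 2 ∂(κ z)| ≤ 4 :=
      fun z => Scoring.abs_kop_le κ hWb z
    have hWjm := measurable_chord_right hθ ((j : ℝ) * q) x
    have hWjb := abs_chord_le (θ := θ) ((j : ℝ) * q) x
    have hiL : Integrable (fun z => (j : ℝ) * ∫ y,
        4 * Real.sin (Real.pi * (θ y - θ x - ((j : ℝ) + 1) * q)) ^ 2 ∂(κ z)) (nHit κ j x) :=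
      (Scoring.integrable_of_bounded _ hIm hIb).const_mul _
    have hiR1 : Integrable (fun z => (j : ℝ) * (1 + j)
        * ∫ y, 4 * Real.sin (Real.pi * (θ y - θ z - q)) ^ 2 ∂(κ z)) (nHit κ j x) :=
      (Scoring.integrable_of_bounded _ hGm hGb).const_mul _
    have hiR2 : Integrable (fun z => (1 + j) * (4 * Real.sin (Real.pi * (θ z - θ x - j * q)) ^ 2))
        (nHit κ j x) := (Scoring.integrable_of_bounded _ hWjm hWjb).const_mul _
    have hiR : Integrable (fun z => (j : ℝ) * (1 + j)
        * ∫ y, 4 * Real.sin (Real.pi * (θ y - θ z - q)) ^ 2 ∂(κ z)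
        + (1 + j) * (4 * Real.sin (Real.pi * (θ z - θ x - j * q)) ^ 2)) (nHit κ j x) := hiR1.add hiR2
    unfold Scoring.kop
    rw [← integral_const_mul (j : ℝ), ← integral_const_mul ((j : ℝ) * (1 + j)),
      ← integral_const_mul (1 + (j : ℝ)), ← integral_add hiR1 hiR2]
    refine integral_mono hiL hiR fun z => ?_
    -- inner inequality at the intermediate point `z`
    have hi1 : Integrable (fun y => (j : ℝ) * (1 + j) * (4 * Real.sin (Real.pi * (θ y - θ z - q)) ^ 2))
        (κ z) := (Scoring.integrable_of_bounded _ (measurable_chord_right hθ q z)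
          (abs_chord_le q z)).const_mul _
    have hconst : (j : ℝ) * (1 + j) * ∫ y, 4 * Real.sin (Real.pi * (θ y - θ z - q)) ^ 2 ∂(κ z)
          + (1 + j) * (4 * Real.sin (Real.pi * (θ z - θ x - j * q)) ^ 2)
        = ∫ y, ((j : ℝ) * (1 + j) * (4 * Real.sin (Real.pi * (θ y - θ z - q)) ^ 2)
          + (1 + j) * (4 * Real.sin (Real.pi * (θ z - θ x - j * q)) ^ 2)) ∂(κ z) := by
      rw [integral_add hi1 (integrable_const _), integral_const_mul ((j : ℝ) * (1 + j)), integral_const,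
        probReal_univ, one_smul]
    show (j : ℝ) * ∫ y, 4 * Real.sin (Real.pi * (θ y - θ x - ((j : ℝ) + 1) * q)) ^ 2 ∂(κ z)
      ≤ (j : ℝ) * (1 + j) * ∫ y, 4 * Real.sin (Real.pi * (θ y - θ z - q)) ^ 2 ∂(κ z)
          + (1 + j) * (4 * Real.sin (Real.pi * (θ z - θ x - j * q)) ^ 2)
    rw [hconst, ← integral_const_mul (j : ℝ)]
    refine integral_mono ((Scoring.integrable_of_bounded _ hWm hWb).const_mul _)
      (hi1.add (integrable_const _)) fun y => ?_
    have htri := mul_sin_sq_add_le (Real.pi * (θ y - θ z - q)) (Real.pi * (θ z - θ x - j * q)) hj0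
    have harg : Real.pi * (θ y - θ x - ((j : ℝ) + 1) * q)
        = Real.pi * (θ y - θ z - q) + Real.pi * (θ z - θ x - j * q) := by ring
    show (j : ℝ) * (4 * Real.sin (Real.pi * (θ y - θ x - ((j : ℝ) + 1) * q)) ^ 2)
      ≤ (j : ℝ) * (1 + j) * (4 * Real.sin (Real.pi * (θ y - θ z - q)) ^ 2)
          + (1 + j) * (4 * Real.sin (Real.pi * (θ z - θ x - j * q)) ^ 2)
    rw [harg]
    nlinarith [htri]
  -- integrate over `π` and use invariance of `π` under `nHit κ j` for the `G` term
  have hLm : Measurable fun x => (j : ℝ) * ∫ y,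
      4 * Real.sin (Real.pi * (θ y - θ x - ((j : ℝ) + 1) * q)) ^ 2 ∂(nHit κ (j + 1) x) :=
    (measurable_integral_chord (nHit κ (j + 1)) hθ _).const_mul _
  have hLb : ∀ x, |(j : ℝ) * ∫ y, 4 * Real.sin (Real.pi * (θ y - θ x - ((j : ℝ) + 1) * q)) ^ 2
      ∂(nHit κ (j + 1) x)| ≤ (j : ℝ) * 4 := fun x => by
    rw [abs_mul, abs_of_nonneg hj0]
    exact mul_le_mul_of_nonneg_left (abs_integral_chord_le (nHit κ (j + 1)) _ x) hj0
  obtain ⟨hKGm, hKGb⟩ := Scoring.iterate_kop_bounded_measurable (nHit κ j) hGm hGb 1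
  simp only [Function.iterate_one] at hKGm hKGb
  have hR1m : Measurable fun x => (j : ℝ) * (1 + j) * Scoring.kop (nHit κ j)
      (fun z => ∫ y, 4 * Real.sin (Real.pi * (θ y - θ z - q)) ^ 2 ∂(κ z)) x := hKGm.const_mul _
  have hR1b : ∀ x, |(j : ℝ) * (1 + j) * Scoring.kop (nHit κ j)
      (fun z => ∫ y, 4 * Real.sin (Real.pi * (θ y - θ z - q)) ^ 2 ∂(κ z)) x| ≤ (j : ℝ) * (1 + j) * 4 :=
    fun x => by
      rw [abs_mul, abs_of_nonneg (mul_nonneg hj0 hj1)]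
      exact mul_le_mul_of_nonneg_left (hKGb x) (mul_nonneg hj0 hj1)
  have hR2m : Measurable fun x => (1 + (j : ℝ)) * ∫ z,
      4 * Real.sin (Real.pi * (θ z - θ x - j * q)) ^ 2 ∂(nHit κ j x) :=
    (measurable_integral_chord (nHit κ j) hθ _).const_mul _
  have hR2b : ∀ x, |(1 + (j : ℝ)) * ∫ z, 4 * Real.sin (Real.pi * (θ z - θ x - j * q)) ^ 2
      ∂(nHit κ j x)| ≤ (1 + j) * 4 := fun x => by
    rw [abs_mul, abs_of_nonneg hj1]
    exact mul_le_mul_of_nonneg_left (abs_integral_chord_le (nHit κ j) _ x) hj1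
  have hiL := Scoring.integrable_of_bounded π hLm hLb
  have hiR1 := Scoring.integrable_of_bounded π hR1m hR1b
  have hiR2 := Scoring.integrable_of_bounded π hR2m hR2b
  have hiR : Integrable (fun x => (j : ℝ) * (1 + j) * Scoring.kop (nHit κ j)
      (fun z => ∫ y, 4 * Real.sin (Real.pi * (θ y - θ z - q)) ^ 2 ∂(κ z)) x
      + (1 + (j : ℝ)) * ∫ z, 4 * Real.sin (Real.pi * (θ z - θ x - j * q)) ^ 2 ∂(nHit κ j x)) π :=
    hiR1.add hiR2
  have hint := integral_mono hiL hiR hpt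
  rw [integral_const_mul (j : ℝ), integral_add hiR1 hiR2, integral_const_mul ((j : ℝ) * (1 + j)),
    integral_const_mul (1 + (j : ℝ)), Scoring.integral_kop (nHit κ j) (invariant_nHit hπ j) hGm hGb] at hint
  exact hint

/-- **`D_j ≤ j² D`** for every `j ≥ 1`. -/
theorem chord_nHit_le (hπ : Kernel.Invariant κ π) {θ : S → ℝ} (hθ : Measurable θ) (q : ℝ)
    {j : ℕ} (hj : 1 ≤ j) :
    ∫ x, ∫ y, 4 * Real.sin (Real.pi * (θ y - θ x - j * q)) ^ 2 ∂(nHit κ j x) ∂π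
      ≤ (j : ℝ) ^ 2 * ∫ x, ∫ y, 4 * Real.sin (Real.pi * (θ y - θ x - q)) ^ 2 ∂(κ x) ∂π := by
  induction j, hj using Nat.le_induction with
  | base =>
    rw [nHit_one, Nat.cast_one, one_pow, one_mul]
    simp only [one_mul]
    exact le_rfl
  | succ j hj ih =>
    have hjpos : (0 : ℝ) < j := by exact_mod_cast hj
    have hrec := chord_recursion hπ hθ q j
    have hD0 : 0 ≤ ∫ x, ∫ y, 4 * Real.sin (Real.pi * (θ y - θ x - q)) ^ 2 ∂(κ x) ∂π :=
      integral_nonneg fun x => integral_chord_nonneg κ q x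
    -- `j D_{j+1} ≤ j(1+j) D + (1+j) j² D = j (1+j)² D`
    have hstep : (j : ℝ) * ∫ x, ∫ y, 4 * Real.sin (Real.pi * (θ y - θ x - ((j : ℝ) + 1) * q)) ^ 2
          ∂(nHit κ (j + 1) x) ∂π
        ≤ (j : ℝ) * ((1 + j) ^ 2 * ∫ x, ∫ y, 4 * Real.sin (Real.pi * (θ y - θ x - q)) ^ 2 ∂(κ x) ∂π) := by
      have h2 : (1 + (j : ℝ)) * ∫ x, ∫ y, 4 * Real.sin (Real.pi * (θ y - θ x - j * q)) ^ 2
            ∂(nHit κ j x) ∂π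
          ≤ (1 + (j : ℝ)) * ((j : ℝ) ^ 2
            * ∫ x, ∫ y, 4 * Real.sin (Real.pi * (θ y - θ x - q)) ^ 2 ∂(κ x) ∂π) :=
        mul_le_mul_of_nonneg_left ih (by linarith)
      nlinarith [hrec, h2, hD0]
    have hfin := le_of_mul_le_mul_left hstep hjpos
    rw [Nat.cast_succ]
    calc ∫ x, ∫ y, 4 * Real.sin (Real.pi * (θ y - θ x - ((j : ℝ) + 1) * q)) ^ 2 ∂(nHit κ (j + 1) x) ∂π
        ≤ (1 + (j : ℝ)) ^ 2 * ∫ x, ∫ y, 4 * Real.sin (Real.pi * (θ y - θ x - q)) ^ 2 ∂(κ x) ∂π := hfin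
      _ = ((j : ℝ) + 1) ^ 2 * ∫ x, ∫ y, 4 * Real.sin (Real.pi * (θ y - θ x - q)) ^ 2 ∂(κ x) ∂π := by
          ring

end Steps

end Summit.Ventures.LatticeQCDFlow.Exactness.GeneralNCMC

namespace Summit.Ventures.LatticeQCDFlow.Exactness.GeneralNCMC

open MeasureTheory ProbabilityTheory
variable {S : Type*} [MeasurableSpace S]

/-! ## §3 (appended by GEN-22, row 13) The chord functional is the deficit of the lag-`j` phase autocorrelation
With `c = cos 2πθ`, `s = sin 2πθ`, `Φ = e^{2πiθ}`, `⟨f, ηg⟩_π = ∫ f · (ηg) dπ` (`η` Markov):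
`∫_π ∫_η W_c = 2 − 2 cos(2πc) (⟨c, ηc⟩_π + ⟨s, ηs⟩_π) − 2 sin(2πc) (⟨c, ηs⟩_π − ⟨s, ηc⟩_π)`, i.e.
`1 − D^η_c / 2 = Re (e^{−2πic} ⟨Φ, ηΦ⟩_π)`; with `η = κ^j`, `c = jq` and §2, the SLOW-MODE floor
`|⟨Φ, κ^j Φ⟩_π| ≥ 1 − j² D / 2`: a phase with small one-step chord `D` stays correlated for
`j ≲ √(2/D)` lags (for a Poisson-type phase `D ≤ 4π² σ²`, §1). -/

section PhaseCorrelation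

variable (η : Kernel S S) [IsMarkovKernel η]

/-- **Inner step**: `∫ W_c(x, y) η(x, dy)
= 2 − 2 cos(2πc) (c(x) ηc(x) + s(x) ηs(x)) − 2 sin(2πc) (c(x) ηs(x) − s(x) ηc(x))`. -/
theorem integral_chord_eq_two_sub_rot {θ : S → ℝ} (hθ : Measurable θ) (c : ℝ) (x : S) :
    ∫ y, 4 * Real.sin (Real.pi * (θ y - θ x - c)) ^ 2 ∂(η x)
      = 2 - 2 * Real.cos (2 * Real.pi * c)
            * (Real.cos (2 * Real.pi * θ x) * Scoring.kop η (fun y => Real.cos (2 * Real.pi * θ y)) x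
              + Real.sin (2 * Real.pi * θ x) * Scoring.kop η (fun y => Real.sin (2 * Real.pi * θ y)) x)
          - 2 * Real.sin (2 * Real.pi * c)
            * (Real.cos (2 * Real.pi * θ x) * Scoring.kop η (fun y => Real.sin (2 * Real.pi * θ y)) x
              - Real.sin (2 * Real.pi * θ x) * Scoring.kop η (fun y => Real.cos (2 * Real.pi * θ y)) x) := by
  have hpt : ∀ y, 4 * Real.sin (Real.pi * (θ y - θ x - c)) ^ 2
      = 2 - 2 * Real.cos (2 * Real.pi * c) * (Real.cos (2 * Real.pi * θ x) * Real.cos (2 * Real.pi * θ y)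
            + Real.sin (2 * Real.pi * θ x) * Real.sin (2 * Real.pi * θ y))
          - 2 * Real.sin (2 * Real.pi * c) * (Real.cos (2 * Real.pi * θ x) * Real.sin (2 * Real.pi * θ y)
            - Real.sin (2 * Real.pi * θ x) * Real.cos (2 * Real.pi * θ y)) := by
    intro y
    rw [← four_sin_sq_pi_eq, show 2 * Real.pi * (θ y - θ x - c)
      = (2 * Real.pi * θ y - 2 * Real.pi * θ x) - 2 * Real.pi * c by ring, Real.cos_sub, Real.cos_sub,
      Real.sin_sub]; ring
  have hcm : Measurable fun y => Real.cos (2 * Real.pi * θ y) := Real.measurable_cos.comp (hθ.const_mul _)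
  have hsm : Measurable fun y => Real.sin (2 * Real.pi * θ y) := Real.measurable_sin.comp (hθ.const_mul _)
  have hic := Scoring.integrable_of_bounded (η x) hcm fun y => Real.abs_cos_le_one (2 * Real.pi * θ y)
  have his := Scoring.integrable_of_bounded (η x) hsm fun y => Real.abs_sin_le_one (2 * Real.pi * θ y)
  have hiA : Integrable (fun y => Real.cos (2 * Real.pi * θ x) * Real.cos (2 * Real.pi * θ y)
      + Real.sin (2 * Real.pi * θ x) * Real.sin (2 * Real.pi * θ y)) (η x) :=
    (hic.const_mul _).add (his.const_mul _)
  have hi1 : Integrable (fun y => (2 : ℝ) - 2 * Real.cos (2 * Real.pi * c)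
      * (Real.cos (2 * Real.pi * θ x) * Real.cos (2 * Real.pi * θ y)
        + Real.sin (2 * Real.pi * θ x) * Real.sin (2 * Real.pi * θ y))) (η x) :=
    (integrable_const _).sub (hiA.const_mul _)
  have hi2 : Integrable (fun y => 2 * Real.sin (2 * Real.pi * c)
      * (Real.cos (2 * Real.pi * θ x) * Real.sin (2 * Real.pi * θ y)
        - Real.sin (2 * Real.pi * θ x) * Real.cos (2 * Real.pi * θ y))) (η x) :=
    ((his.const_mul _).sub (hic.const_mul _)).const_mul _
  simp_rw [hpt]
  unfold Scoring.kop
  rw [integral_sub hi1 hi2, integral_sub (integrable_const _) (hiA.const_mul _), integral_const,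
    probReal_univ, one_smul, integral_const_mul, integral_const_mul,
    integral_add (hic.const_mul _) (his.const_mul _), integral_sub (his.const_mul _) (hic.const_mul _),
    integral_const_mul, integral_const_mul, integral_const_mul, integral_const_mul]

/-- **`1 − D^η_c/2 = Re (e^{−2πic} ⟨Φ, ηΦ⟩_π)`**, written out in real form:
`∫_π ∫_η W_c = 2 − 2 cos(2πc)(⟨c, ηc⟩_π + ⟨s, ηs⟩_π) − 2 sin(2πc)(⟨c, ηs⟩_π − ⟨s, ηc⟩_π)`
(any probability law `π`; no invariance needed). -/
theorem integral_integral_chord_eq_phaseCorr (π : Measure S) [IsProbabilityMeasure π] {θ : S → ℝ}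
    (hθ : Measurable θ) (c : ℝ) :
    ∫ x, ∫ y, 4 * Real.sin (Real.pi * (θ y - θ x - c)) ^ 2 ∂(η x) ∂π
      = 2 - 2 * Real.cos (2 * Real.pi * c)
            * (∫ x, Real.cos (2 * Real.pi * θ x) * Scoring.kop η (fun y => Real.cos (2 * Real.pi * θ y)) x ∂π
              + ∫ x, Real.sin (2 * Real.pi * θ x) * Scoring.kop η (fun y => Real.sin (2 * Real.pi * θ y)) x ∂π)
          - 2 * Real.sin (2 * Real.pi * c)
            * (∫ x, Real.cos (2 * Real.pi * θ x) * Scoring.kop η (fun y => Real.sin (2 * Real.pi * θ y)) x ∂π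
              - ∫ x, Real.sin (2 * Real.pi * θ x) * Scoring.kop η (fun y => Real.cos (2 * Real.pi * θ y)) x ∂π)
    := by
  simp_rw [integral_chord_eq_two_sub_rot η hθ c]
  have hcm : Measurable fun y => Real.cos (2 * Real.pi * θ y) := Real.measurable_cos.comp (hθ.const_mul _)
  have hsm : Measurable fun y => Real.sin (2 * Real.pi * θ y) := Real.measurable_sin.comp (hθ.const_mul _)
  have hcb : ∀ y, |Real.cos (2 * Real.pi * θ y)| ≤ 1 := fun y => Real.abs_cos_le_one _
  have hsb : ∀ y, |Real.sin (2 * Real.pi * θ y)| ≤ 1 := fun y => Real.abs_sin_le_one _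
  -- the four products `f · ηg` are measurable and bounded by `1`
  have hprod : ∀ {f g : S → ℝ}, Measurable f → (∀ y, |f y| ≤ 1) → Measurable g → (∀ y, |g y| ≤ 1) →
      Integrable (fun x => f x * Scoring.kop η g x) π := by
    intro f g hfm hfb hgm hgb
    refine Scoring.integrable_of_bounded π (hfm.mul (Scoring.measurable_kop η hgm)) (C := 1 * 1)
      fun x => ?_
    rw [abs_mul]
    exact mul_le_mul (hfb x) (Scoring.abs_kop_le η hgb x) (abs_nonneg _) zero_le_one
  have hcc := hprod hcm hcb hcm hcb; have hss := hprod hsm hsb hsm hsb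
  have hcs := hprod hcm hcb hsm hsb; have hsc := hprod hsm hsb hcm hcb
  have hiA : Integrable (fun x => Real.cos (2 * Real.pi * θ x)
        * Scoring.kop η (fun y => Real.cos (2 * Real.pi * θ y)) x
      + Real.sin (2 * Real.pi * θ x) * Scoring.kop η (fun y => Real.sin (2 * Real.pi * θ y)) x) π :=
    hcc.add hss
  have hiB : Integrable (fun x => Real.cos (2 * Real.pi * θ x)
        * Scoring.kop η (fun y => Real.sin (2 * Real.pi * θ y)) x
      - Real.sin (2 * Real.pi * θ x) * Scoring.kop η (fun y => Real.cos (2 * Real.pi * θ y)) x) π :=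
    hcs.sub hsc
  have hi1 : Integrable (fun x => (2 : ℝ) - 2 * Real.cos (2 * Real.pi * c)
      * (Real.cos (2 * Real.pi * θ x) * Scoring.kop η (fun y => Real.cos (2 * Real.pi * θ y)) x
        + Real.sin (2 * Real.pi * θ x) * Scoring.kop η (fun y => Real.sin (2 * Real.pi * θ y)) x)) π :=
    (integrable_const _).sub (hiA.const_mul _)
  have hi2 : Integrable (fun x => 2 * Real.sin (2 * Real.pi * c)
      * (Real.cos (2 * Real.pi * θ x) * Scoring.kop η (fun y => Real.sin (2 * Real.pi * θ y)) x
        - Real.sin (2 * Real.pi * θ x) * Scoring.kop η (fun y => Real.cos (2 * Real.pi * θ y)) x)) π :=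
    hiB.const_mul _
  rw [integral_sub hi1 hi2, integral_sub (integrable_const _) (hiA.const_mul _), integral_const,
    probReal_univ, one_smul, integral_const_mul, integral_const_mul, integral_add hcc hss,
    integral_sub hcs hsc]

/-- `cos β · P + sin β · Q ≤ √(P² + Q²)` (Cauchy–Schwarz in the plane). -/
theorem cos_mul_add_sin_mul_le_sqrt (β P Q : ℝ) :
    Real.cos β * P + Real.sin β * Q ≤ Real.sqrt (P ^ 2 + Q ^ 2) :=
  (le_abs_self _).trans (Real.abs_le_sqrt (by
    nlinarith [sq_nonneg (Real.cos β * Q - Real.sin β * P), Real.cos_sq_add_sin_sq β]))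

variable {κ : Kernel S S} [IsMarkovKernel κ] {π : Measure S} [IsProbabilityMeasure π]

/-- **Slow-mode floor, real form**: `π` invariant, `j ≥ 1`:
`1 − (j²/2) D ≤ cos(2πjq)(⟨c, κ^j c⟩_π + ⟨s, κ^j s⟩_π) + sin(2πjq)(⟨c, κ^j s⟩_π − ⟨s, κ^j c⟩_π)`
(`= Re (e^{−2πijq} ⟨Φ, κ^j Φ⟩_π)`), `D = ∫_π ∫_κ W_q` the one-step chord. -/
theorem one_sub_sq_mul_chord_le_phaseCorr (hπ : Kernel.Invariant κ π) {θ : S → ℝ} (hθ : Measurable θ)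
    (q : ℝ) {j : ℕ} (hj : 1 ≤ j) :
    1 - (j : ℝ) ^ 2 / 2 * ∫ x, ∫ y, 4 * Real.sin (Real.pi * (θ y - θ x - q)) ^ 2 ∂(κ x) ∂π
      ≤ Real.cos (2 * Real.pi * (j * q))
            * (∫ x, Real.cos (2 * Real.pi * θ x)
                * Scoring.kop (nHit κ j) (fun y => Real.cos (2 * Real.pi * θ y)) x ∂π
              + ∫ x, Real.sin (2 * Real.pi * θ x)
                * Scoring.kop (nHit κ j) (fun y => Real.sin (2 * Real.pi * θ y)) x ∂π)
          + Real.sin (2 * Real.pi * (j * q))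
            * (∫ x, Real.cos (2 * Real.pi * θ x)
                * Scoring.kop (nHit κ j) (fun y => Real.sin (2 * Real.pi * θ y)) x ∂π
              - ∫ x, Real.sin (2 * Real.pi * θ x)
                * Scoring.kop (nHit κ j) (fun y => Real.cos (2 * Real.pi * θ y)) x ∂π) := by
  haveI := isMarkovKernel_nHit κ j
  have hid := integral_integral_chord_eq_phaseCorr (nHit κ j) π hθ ((j : ℝ) * q)
  have hle := chord_nHit_le hπ hθ q hj
  linarith

/-- **Slow-mode floor, modulus form**: `1 − (j²/2) D ≤ |⟨Φ, κ^j Φ⟩_π| = √(P² + Q²)` with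
`P = ⟨c, κ^j c⟩_π + ⟨s, κ^j s⟩_π`, `Q = ⟨c, κ^j s⟩_π − ⟨s, κ^j c⟩_π`: the (uncentred) lag-`j`
autocorrelation of the circle observable `Φ = e^{2πiθ}` cannot fall below `1 − j² D/2`. -/
theorem one_sub_sq_mul_chord_le_sqrt_phaseCorr (hπ : Kernel.Invariant κ π) {θ : S → ℝ}
    (hθ : Measurable θ) (q : ℝ) {j : ℕ} (hj : 1 ≤ j) :
    1 - (j : ℝ) ^ 2 / 2 * ∫ x, ∫ y, 4 * Real.sin (Real.pi * (θ y - θ x - q)) ^ 2 ∂(κ x) ∂π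
      ≤ Real.sqrt
          ((∫ x, Real.cos (2 * Real.pi * θ x)
                * Scoring.kop (nHit κ j) (fun y => Real.cos (2 * Real.pi * θ y)) x ∂π
              + ∫ x, Real.sin (2 * Real.pi * θ x)
                * Scoring.kop (nHit κ j) (fun y => Real.sin (2 * Real.pi * θ y)) x ∂π) ^ 2
            + (∫ x, Real.cos (2 * Real.pi * θ x)
                * Scoring.kop (nHit κ j) (fun y => Real.sin (2 * Real.pi * θ y)) x ∂π
              - ∫ x, Real.sin (2 * Real.pi * θ x)
                * Scoring.kop (nHit κ j) (fun y => Real.cos (2 * Real.pi * θ y)) x ∂π) ^ 2) :=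
  (one_sub_sq_mul_chord_le_phaseCorr hπ hθ q hj).trans (cos_mul_add_sin_mul_le_sqrt _ _ _)

end PhaseCorrelation

end Summit.Ventures.LatticeQCDFlow.Exactness.GeneralNCMC
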